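import Literature.NumberTheory.EllipticCurves.BinaryQuarticIrreducibleDiscProofs
import Literature.NumberTheory.Sieve.DivisorBound
import Mathlib.RingTheory.Polynomial.GaussLemma
import Mathlib.NumberTheory.Divisors
import HarnessLib

/-!
# Bhargava–Shankar, Lemma 2.3: integral binary quartic forms that are reducible over `ℚ` with
# `a ≠ 0` are negligible — the counting core, in box form

`Proofs` companion (theorems only: no definitions, no named facts) of `BinaryQuarticForms.lean`
(`BinaryQuartic.IsIrreducible`, the class counts `N(S; X)` of Thm 2.1 =
`Literature.NumberTheory.EllipticCurves.bhargavaShankar_classCount`, which count *irreducible*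
forms). Source: M. Bhargava, A. Shankar, *Binary quartic forms having bounded invariants, and the
boundedness of the average rank of elliptic curves*, Ann. of Math. (2) 181 (2015) 191–242, §2.2
"Estimates on reducibility", **Lemma 2.3** (same number in the held arXiv text `arXiv:1006.1002v2`,
p. 9–10, and in the published version):

> *Let `h ∈ G₀` be any element, where `G₀` is any fixed compact subset of `GL₂(ℝ)`. Then the
> number of integral binary quartic forms `ax⁴ + bx³y + cx²y² + dxy³ + ey⁴ ∈ 𝓡_X(hL_V^{(i)})` that
> are reducible over `ℚ` with `a ≠ 0` is `O(X^{2/3+ε})`, where the implied constant depends only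
> on `G₀`.*

In the proof of Thm 2.1 (§2.3) the lattice points with `a ≠ 0` in the boxes `B(n, t, λ, X)` are
counted by Davenport's lemma (Prop. 2.6), and Lemma 2.3 is what allows one to discard the reducible
ones among them ("up to an error of `O(X^{2/3+ε})` due to the estimates on reducible forms in
Lemma 2.3", display (14)).

## What is proved

The printed proof is a counting argument on the coefficients: a point of
`𝓡_X(hL) ⊂ N'A'KΛ hL`, `λ < X^{1/24}`, has `a ≪ λ⁴t⁻⁴`, `b ≪ λ⁴t⁻²`, `c ≪ λ⁴`, `d ≪ λ⁴t²`,
`e ≪ λ⁴t⁴` (whence the printed "`a, b, c = O(X^{1/6})`, `ad, bd, ae = O(X^{2/6})`"), and inside such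
a coefficient box the reducible forms with `a ≠ 0` are few because a factorisation over `ℤ` is
pinned down, up to divisor-function choices, by four of the five coefficients. This file proves
exactly that mechanism, for an **arbitrary coefficient box** — the form in which it is consumed by
any decomposition of `𝓡_X(hL)` into boxes (the passage from the region to boxes belongs to the
reduction theory of §2.1–2.3 and is not done here):

* `BinaryQuartic.ncard_reducible_box_le` — **for every `ε > 0` there is `K` such that for all
  integers `A, B, C, D, E ≥ 1`, the number of `f = (a, b, c, d, e) ∈ V_ℤ` with `a ≠ 0`, `f` not
  irreducible, `|a| ≤ A`, `|b| ≤ B`, `|c| ≤ C`, `|d| ≤ D`, `|e| ≤ E` is at most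
  `K · (AE)^ε · (ABCD + ABDE + ABCE)`**; `BinaryQuartic.ncard_reducible_realBox_le` is the same
  with real bounds `A, …, E ≥ 1`. (For the boxes of the paper, `ABDE ≍ ABCD ≍ ABCE/t² ≍ λ¹⁶ ≤ X^{2/3}`.)

The steps, following the printed proof (p. 10 of the held text):

1. (`exists_mul_eq_toPoly_of_not_isIrreducible`, Gauss's lemma) if `a ≠ 0` and `f(x, 1)` is
   reducible in `ℚ[X]` then `f(x, 1) = G · H` in `ℤ[X]` with `(deg G, deg H) = (1, 3)` or `(2, 2)`;
   in coefficients (`eq_linMulCubic_of_toPoly_eq`, `eq_quadMulQuad_of_toPoly_eq`)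
   `f = (pr, ps + qr, pt + qs, pu + qt, qu)` ("`px + qy` is a linear factor, `p ∣ a`, `q ∣ e`") or
   `f = (ps, pt + qs, pu + qt + rs, qu + rt, ru)` (two quadratic factors, `p ∣ a`, `r ∣ e`).
2. Forms with `e = 0`: at most `(2A+1)(2B+1)(2C+1)(2D+1)` ("the number of points with `a ≠ 0` and
   `e = 0`").
3. Linear factor, `e ≠ 0`: `f` is the image of `((p, r), (q, u), b, d)` with `pr = a`, `qu = e`
   (pairs of complementary divisors, `Int.divisorsAntidiag`), since `s = (b − qr)/p`,
   `t = (d − pu)/q` and then `c = pt + qs` are determined ("computing `f(−q, p)` and setting it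
   equal to zero then uniquely determines `c`").
4. Two quadratic factors, `e ≠ 0`, with `ps = a`, `ru = e`: the linear system `sq + pt = b`,
   `uq + rt = d` (display (11)) in `q, t` has determinant `δ = sr − pu`; if `δ ≠ 0` then `(b, d)`
   determine `(q, t)` and then `c` ("nonsingular" case), and if `δ = 0` then `d = rb/p` is determined
   by `b`, so `f` is the image of `((p, s), (r, u), b, c)` ("singular" case).
5. The number of pairs `((p, ·), (r, ·))` of complementary divisors of `(a, e)`, summed over the
   box, is `≤ (2A+1)(2E+1) · 4 d(|a|) d(|e|) ≤ 36 K_ε² (AE)^{1+ε}` by the divisor bound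
   `d(n) ≤ K_ε n^ε` (`Literature.NumberTheory.Sieve.exists_card_divisors_le_mul_rpow'`,
   Hardy–Wright Thm 315), whence the total
   `81·ABCD + 36K²(AE)^{1+ε}(18·BD + 9·BC) ≤ 648 K² (AE)^ε (ABCD + ABDE + ABCE)`.

## References

* M. Bhargava, A. Shankar, Ann. of Math. (2) 181 (2015) 191–242 = arXiv:1006.1002, §2.2,
  Lemma 2.3 and its proof; §2.3 display (14).
  [cite: BhargavaShankarAnnals2015, Lemma 2.3 (arXiv:1006.1002v2 numbering = published numbering)]
* G. H. Hardy, E. M. Wright, *An Introduction to the Theory of Numbers*, Thm 315 (`d(n) = O(n^ε)`),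
  through the tree file `Literature/NumberTheory/Sieve/DivisorBound.lean`.

## Tree / Mathlib reuse

Tree: `BinaryQuartic.toPoly`, `IsIrreducible` (`BinaryQuarticForms`); `toPoly_map`
(`BinaryQuarticIrreducibleDiscProofs`); `toPoly_injective`, `natDegree_toPoly`, `toPoly_ne_zero`
(`BhargavaShankarCountingProofs`); `exists_card_divisors_le_mul_rpow'` (`Sieve/DivisorBound`).
Mathlib: `Polynomial.IsPrimitive.Int.irreducible_iff_irreducible_map_cast` (Gauss's lemma),
`Polynomial.eq_C_content_mul_primPart`, `Int.divisorsAntidiag`, `Int.divisors`, `Int.card_Icc`.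
-/

noncomputable section

open scoped Classical
open Polynomial Finset

namespace Literature.NumberTheory.EllipticCurves

namespace BinaryQuartic

/-! ## §1 Integral factorisations of a reducible form (Gauss's lemma) -/

/-- `f(x,1)` of the product of a linear and a cubic form:
`(px + q)(rx³ + sx² + tx + u) ↔ (pr, ps + qr, pt + qs, pu + qt, qu)`. [folklore] -/
theorem toPoly_linMulCubic (p q r s t u : ℤ) :
    (⟨p * r, p * s + q * r, p * t + q * s, p * u + q * t, q * u⟩ : BinaryQuartic ℤ).toPoly =
      (C p * X + C q) * (C r * X ^ 3 + C s * X ^ 2 + C t * X + C u) := by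
  simp only [toPoly, C_mul, C_add]
  ring

/-- `f(x,1)` of the product of two quadratic forms:
`(px² + qx + r)(sx² + tx + u) ↔ (ps, pt + qs, pu + qt + rs, qu + rt, ru)` (Bhargava–Shankar,
proof of Lemma 2.3, display (11)). [cite: BhargavaShankarAnnals2015, Lemma 2.3 (proof, display (11); arXiv:1006.1002v2 numbering)] -/
theorem toPoly_quadMulQuad (p q r s t u : ℤ) :
    (⟨p * s, p * t + q * s, p * u + q * t + r * s, q * u + r * t, r * u⟩ : BinaryQuartic ℤ).toPoly =
      (C p * X ^ 2 + C q * X + C r) * (C s * X ^ 2 + C t * X + C u) := by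
  simp only [toPoly, C_mul, C_add]
  ring

/-- A polynomial of degree `≤ 3` written out. [folklore] -/
theorem eq_cubic_of_natDegree_le_three {H : ℤ[X]} (hH : H.natDegree ≤ 3) :
    H = C (H.coeff 3) * X ^ 3 + C (H.coeff 2) * X ^ 2 + C (H.coeff 1) * X + C (H.coeff 0) := by
  ext n
  simp only [coeff_add, coeff_C_mul, coeff_X_pow, coeff_X, coeff_C]
  rcases n with _ | _ | _ | _ | n
  · simp
  · simp
  · simp
  · simp
  · have h4 : n + 4 ≠ 3 := by omega
    have h2 : n + 4 ≠ 2 := by omega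
    have h1 : (1 : ℕ) ≠ n + 4 := by omega
    have h0 : n + 4 ≠ 0 := by omega
    simp only [h4, h2, h1, h0, if_false, mul_zero, add_zero]
    exact coeff_eq_zero_of_natDegree_lt (by omega)

/-- A polynomial of degree `≤ 2` written out. [folklore] -/
theorem eq_quad_of_natDegree_le_two {G : ℤ[X]} (hG : G.natDegree ≤ 2) :
    G = C (G.coeff 2) * X ^ 2 + C (G.coeff 1) * X + C (G.coeff 0) := by
  ext n
  simp only [coeff_add, coeff_C_mul, coeff_X_pow, coeff_X, coeff_C]
  rcases n with _ | _ | _ | n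
  · simp
  · simp
  · simp
  · have h2 : n + 3 ≠ 2 := by omega
    have h1 : (1 : ℕ) ≠ n + 3 := by omega
    have h0 : n + 3 ≠ 0 := by omega
    simp only [h2, h1, h0, if_false, mul_zero, add_zero]
    exact coeff_eq_zero_of_natDegree_lt (by omega)

/-- **Gauss's lemma for a reducible form.** If `a ≠ 0` and `f` is not irreducible (i.e. `f(x,1)`
is reducible in `ℚ[X]`), then `f(x,1) = G · H` in `ℤ[X]` with `(deg G, deg H) = (1, 3)` or
`(2, 2)`: pass to the primitive part of `f(x,1)`, which is reducible over `ℤ` by Gauss's lemma,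
and whose non-unit factors have positive degree (Bhargava–Shankar, proof of Lemma 2.3: "forms that
have a rational linear factor … forms that factor into two irreducible binary quadratic forms
over `ℤ`"). [cite: BhargavaShankarAnnals2015, Lemma 2.3 (proof; arXiv:1006.1002v2 numbering)] -/
theorem exists_mul_eq_toPoly_of_not_isIrreducible {f : BinaryQuartic ℤ} (ha : f.a ≠ 0)
    (hf : ¬ f.IsIrreducible) :
    ∃ G H : ℤ[X], f.toPoly = G * H ∧
      ((G.natDegree = 1 ∧ H.natDegree = 3) ∨ (G.natDegree = 2 ∧ H.natDegree = 2)) := by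
  have hirr : ¬ Irreducible (f.map (Int.castRingHom ℚ)).toPoly := fun h ↦ hf ⟨ha, h⟩
  rw [toPoly_map] at hirr
  set P := f.toPoly with hP
  have hP0 : P ≠ 0 := toPoly_ne_zero ha
  have hPdeg : P.natDegree = 4 := natDegree_toPoly ha
  have hc0 : P.content ≠ 0 := by rwa [Ne, content_eq_zero_iff]
  have hprim : P.primPart.IsPrimitive := P.isPrimitive_primPart
  have hdeg₀ : P.primPart.natDegree = 4 := by rw [natDegree_primPart, hPdeg]
  -- the primitive part is reducible over `ℤ`
  have hirr₀ : ¬ Irreducible P.primPart := by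
    intro h
    apply hirr
    rw [P.eq_C_content_mul_primPart, Polynomial.map_mul, Polynomial.map_C]
    refine (irreducible_isUnit_mul ?_).mpr
      ((IsPrimitive.Int.irreducible_iff_irreducible_map_cast hprim).mp h)
    exact isUnit_C.mpr (isUnit_iff_ne_zero.mpr (by simpa using hc0))
  have hnu : ¬ IsUnit P.primPart := fun h ↦ by
    have := natDegree_eq_zero_of_isUnit h
    omega
  obtain ⟨G, H, hGH, hGu, hHu⟩ : ∃ G H, P.primPart = G * H ∧ ¬ IsUnit G ∧ ¬ IsUnit H := by
    have h := hirr₀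
    rw [irreducible_iff] at h
    push Not at h
    exact h hnu
  -- non-unit factors of a primitive polynomial have positive degree
  have hpos : ∀ Q : ℤ[X], Q ∣ P.primPart → ¬ IsUnit Q → 0 < Q.natDegree := by
    intro Q hQ hQu
    by_contra h0
    push Not at h0
    have h0' : Q.natDegree = 0 := by omega
    have hQprim : Q.IsPrimitive := isPrimitive_of_dvd hprim hQ
    apply hQu
    rw [eq_C_of_natDegree_eq_zero h0'] at hQprim ⊢
    exact isUnit_C.mpr (isPrimitive_iff_isUnit_of_C_dvd.mp hQprim _ dvd_rfl)
  have hG0 : G ≠ 0 := by rintro rfl; exact hprim.ne_zero (by rw [hGH, zero_mul])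
  have hH0 : H ≠ 0 := by rintro rfl; exact hprim.ne_zero (by rw [hGH, mul_zero])
  have hGpos : 0 < G.natDegree := hpos G ⟨H, hGH⟩ hGu
  have hHpos : 0 < H.natDegree := hpos H ⟨G, by rw [hGH, mul_comm]⟩ hHu
  have hsum : G.natDegree + H.natDegree = 4 := by
    rw [← natDegree_mul hG0 hH0, ← hGH, hdeg₀]
  -- `P = (C c · G) · H`
  have hPGH : P = (C P.content * G) * H := by
    rw [mul_assoc, ← hGH]; exact P.eq_C_content_mul_primPart
  have hdegCG : (C P.content * G).natDegree = G.natDegree := natDegree_C_mul hc0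
  rcases Nat.lt_or_ge G.natDegree 3 with hG3 | hG3
  · rcases Nat.lt_or_ge G.natDegree 2 with hG2 | hG2
    · exact ⟨C P.content * G, H, hPGH, Or.inl ⟨by omega, by omega⟩⟩
    · exact ⟨C P.content * G, H, hPGH, Or.inr ⟨by omega, by omega⟩⟩
  · exact ⟨H, C P.content * G, hPGH.trans (mul_comm _ _), Or.inl ⟨by omega, by omega⟩⟩

/-- Coefficients of a form with a linear factor: if `f(x,1) = G · H` with `deg G ≤ 1`, `deg H ≤ 3`,
then `f = (pr, ps + qr, pt + qs, pu + qt, qu)` with `G = px + q`, `H = rx³ + sx² + tx + u`.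
[cite: BhargavaShankarAnnals2015, Lemma 2.3 (proof: "p must be a factor of a, while q must be a factor of e"; arXiv:1006.1002v2 numbering)] -/
theorem eq_linMulCubic_of_toPoly_eq {f : BinaryQuartic ℤ} {G H : ℤ[X]} (h : f.toPoly = G * H)
    (hG : G.natDegree ≤ 1) (hH : H.natDegree ≤ 3) :
    f = ⟨G.coeff 1 * H.coeff 3, G.coeff 1 * H.coeff 2 + G.coeff 0 * H.coeff 3,
      G.coeff 1 * H.coeff 1 + G.coeff 0 * H.coeff 2, G.coeff 1 * H.coeff 0 + G.coeff 0 * H.coeff 1,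
      G.coeff 0 * H.coeff 0⟩ := by
  apply toPoly_injective
  rw [h, toPoly_linMulCubic, ← eq_X_add_C_of_natDegree_le_one hG,
    ← eq_cubic_of_natDegree_le_three hH]

/-- Coefficients of a product of two quadratic forms: if `f(x,1) = G · H` with `deg G ≤ 2`,
`deg H ≤ 2`, then `f = (ps, pt + qs, pu + qt + rs, qu + rt, ru)` with `G = px² + qx + r`,
`H = sx² + tx + u`. [cite: BhargavaShankarAnnals2015, Lemma 2.3 (proof, display (11); arXiv:1006.1002v2 numbering)] -/
theorem eq_quadMulQuad_of_toPoly_eq {f : BinaryQuartic ℤ} {G H : ℤ[X]} (h : f.toPoly = G * H)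
    (hG : G.natDegree ≤ 2) (hH : H.natDegree ≤ 2) :
    f = ⟨G.coeff 2 * H.coeff 2, G.coeff 2 * H.coeff 1 + G.coeff 1 * H.coeff 2,
      G.coeff 2 * H.coeff 0 + G.coeff 1 * H.coeff 1 + G.coeff 0 * H.coeff 2,
      G.coeff 1 * H.coeff 0 + G.coeff 0 * H.coeff 1, G.coeff 0 * H.coeff 0⟩ := by
  apply toPoly_injective
  rw [h, toPoly_quadMulQuad, ← eq_quad_of_natDegree_le_two hG, ← eq_quad_of_natDegree_le_two hH]

/-- **The two shapes of a reducible form with `a ≠ 0`.** If `a ≠ 0` and `f` is not irreducible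
then either `f = (pr, ps + qr, pt + qs, pu + qt, qu)` (a linear factor `px + qy`) or
`f = (ps, pt + qs, pu + qt + rs, qu + rt, ru)` (two quadratic factors) for some integers
`p, q, r, s, t, u`. [cite: BhargavaShankarAnnals2015, Lemma 2.3 (proof; arXiv:1006.1002v2 numbering)] -/
theorem shape_of_not_isIrreducible {f : BinaryQuartic ℤ} (ha : f.a ≠ 0) (hf : ¬ f.IsIrreducible) :
    (∃ p q r s t u : ℤ, f = ⟨p * r, p * s + q * r, p * t + q * s, p * u + q * t, q * u⟩) ∨
    (∃ p q r s t u : ℤ,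
      f = ⟨p * s, p * t + q * s, p * u + q * t + r * s, q * u + r * t, r * u⟩) := by
  obtain ⟨G, H, h, hdeg | hdeg⟩ := exists_mul_eq_toPoly_of_not_isIrreducible ha hf
  · exact Or.inl ⟨_, _, _, _, _, _, eq_linMulCubic_of_toPoly_eq h hdeg.1.le hdeg.2.le⟩
  · exact Or.inr ⟨_, _, _, _, _, _, eq_quadMulQuad_of_toPoly_eq h hdeg.1.le hdeg.2.le⟩

/-! ## §2 Divisor pairs: `#{(p, r) : pr = z} = 2 d(|z|) ≤ 2 K_ε |z|^ε` -/

/-- `#(Int.divisors z) = 2 · d(|z|)`. [folklore] -/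
theorem card_intDivisors (z : ℤ) : (Int.divisors z).card = 2 * z.natAbs.divisors.card := by
  unfold Int.divisors
  rw [card_disjUnion, card_map, card_map]
  ring

/-- The pairs of complementary divisors of `z` are as many as the divisors: `(p, r) ↦ p` is a
bijection onto `Int.divisors z`. [folklore] -/
theorem card_divisorsAntidiag (z : ℤ) : (Int.divisorsAntidiag z).card = (Int.divisors z).card := by
  rw [← Int.image_fst_divisorsAntidiag]
  refine (card_image_of_injOn ?_).symm
  rintro ⟨p, r⟩ hp ⟨p', r'⟩ hp' (hpp : p = p')
  simp only [mem_coe, Int.mem_divisorsAntidiag] at hp hp'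
  subst hpp
  have hp0 : p ≠ 0 := by rintro rfl; exact hp.2 (by rw [← hp.1, zero_mul])
  have : r = r' := mul_left_cancel₀ hp0 (hp.1.trans hp'.1.symm)
  rw [this]

/-- `#{(p, r) : pr = z} = 2 d(|z|)`. [folklore] -/
theorem card_divisorsAntidiag_eq (z : ℤ) :
    (Int.divisorsAntidiag z).card = 2 * z.natAbs.divisors.card := by
  rw [card_divisorsAntidiag, card_intDivisors]

/-- The divisor bound on pairs: for `|z| ≤ A`, `#{(p, r) : pr = z} ≤ 2 K |z|^ε ≤ 2 K A^ε`, where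
`K = K_ε` is a constant with `d(n) ≤ K n^ε` (Hardy–Wright Thm 315). [folklore] -/
theorem card_divisorsAntidiag_le {ε K : ℝ} (hε : 0 < ε)
    (hK : ∀ n : ℕ, ((n.divisors.card : ℕ) : ℝ) ≤ K * (n : ℝ) ^ ε) {z : ℤ} {A : ℕ}
    (hz : |z| ≤ A) : ((Int.divisorsAntidiag z).card : ℝ) ≤ 2 * K * (A : ℝ) ^ ε := by
  rw [card_divisorsAntidiag_eq, Nat.cast_mul, Nat.cast_two, mul_assoc]
  refine mul_le_mul_of_nonneg_left ((hK _).trans ?_) (by norm_num)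
  have hK0 : 0 ≤ K := by
    have h1 := hK 1
    simp only [Nat.divisors_one, card_singleton, Nat.cast_one, Real.one_rpow, mul_one] at h1
    linarith
  refine mul_le_mul_of_nonneg_left (Real.rpow_le_rpow (Nat.cast_nonneg _) ?_ hε.le) hK0
  have : (z.natAbs : ℤ) ≤ A := by rw [Int.natCast_natAbs]; exact hz
  exact_mod_cast this

/-- The number of quadruples `((p, r), (q, u))` with `pr = a`, `qu = e`, `|a| ≤ A`, `|e| ≤ E`
(`a, e ≠ 0`): at most `(2A+1)(2E+1) · 4K²A^εE^ε`. [cite: BhargavaShankarAnnals2015, Lemma 2.3 (proof: "they are thus both determined up to O(X^ε) possibilities"; arXiv:1006.1002v2 numbering)] -/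
theorem card_divisorPairs_le {ε K : ℝ} (hε : 0 < ε)
    (hK : ∀ n : ℕ, ((n.divisors.card : ℕ) : ℝ) ≤ K * (n : ℝ) ^ ε) (A E : ℕ) :
    ((((Icc (-(A : ℤ)) A) ×ˢ (Icc (-(E : ℤ)) E)).biUnion
        (fun ae : ℤ × ℤ ↦ Int.divisorsAntidiag ae.1 ×ˢ Int.divisorsAntidiag ae.2)).card : ℝ) ≤
      (2 * A + 1) * (2 * E + 1) * (4 * K ^ 2 * (A : ℝ) ^ ε * (E : ℝ) ^ ε) := by
  set S := (Icc (-(A : ℤ)) A) ×ˢ (Icc (-(E : ℤ)) E) with hS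
  have hcardS : (S.card : ℝ) = (2 * A + 1) * (2 * E + 1) := by
    rw [hS, card_product, Int.card_Icc, Int.card_Icc]
    have hA : ((A : ℤ) + 1 - -(A : ℤ)).toNat = 2 * A + 1 := by omega
    have hE : ((E : ℤ) + 1 - -(E : ℤ)).toNat = 2 * E + 1 := by omega
    rw [hA, hE]; push_cast; ring
  calc (((S.biUnion fun ae : ℤ × ℤ ↦ Int.divisorsAntidiag ae.1 ×ˢ Int.divisorsAntidiag ae.2).card
          : ℕ) : ℝ)
      ≤ ((∑ ae ∈ S, (Int.divisorsAntidiag ae.1 ×ˢ Int.divisorsAntidiag ae.2).card : ℕ) : ℝ) := by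
        exact_mod_cast card_biUnion_le
    _ = ∑ ae ∈ S, ((Int.divisorsAntidiag ae.1).card : ℝ) * (Int.divisorsAntidiag ae.2).card := by
        push_cast
        refine sum_congr rfl fun ae _ ↦ ?_
        rw [card_product, Nat.cast_mul]
    _ ≤ ∑ _ae ∈ S, (2 * K * (A : ℝ) ^ ε) * (2 * K * (E : ℝ) ^ ε) := by
        refine sum_le_sum fun ae hae ↦ ?_
        rw [hS, mem_product, mem_Icc, mem_Icc] at hae
        have ha : |ae.1| ≤ A := abs_le.mpr hae.1
        have he : |ae.2| ≤ E := abs_le.mpr hae.2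
        exact mul_le_mul (card_divisorsAntidiag_le hε hK ha) (card_divisorsAntidiag_le hε hK he)
          (Nat.cast_nonneg _) ((Nat.cast_nonneg _).trans (card_divisorsAntidiag_le hε hK ha))
    _ = (2 * A + 1) * (2 * E + 1) * (4 * K ^ 2 * (A : ℝ) ^ ε * (E : ℝ) ^ ε) := by
        rw [sum_const, nsmul_eq_mul, hcardS]; ring

/-! ## §3 The four families and their sizes -/

/-- Membership in the integer interval `[-N, N]` from `|x| ≤ N`. [folklore] -/
theorem mem_Icc_of_abs_le {N : ℕ} {x : ℤ} (h : |x| ≤ N) : x ∈ Icc (-(N : ℤ)) N := by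
  rw [mem_Icc]; exact abs_le.mp h

/-- `#[-N, N] = 2N + 1`. [folklore] -/
theorem card_Icc_neg_self (N : ℕ) : (Icc (-(N : ℤ)) N).card = 2 * N + 1 := by
  rw [Int.card_Icc]; omega

/-- Membership in the finset of divisor pairs `{((p,r),(q,u)) : pr = a, qu = e, |a| ≤ A, |e| ≤ E}`.
[folklore] -/
theorem mem_divisorPairs {A E : ℕ} {p r q u : ℤ} (hpr : p * r ≠ 0) (hqu : q * u ≠ 0)
    (hA : |p * r| ≤ A) (hE : |q * u| ≤ E) :
    ((p, r), (q, u)) ∈ ((Icc (-(A : ℤ)) A) ×ˢ (Icc (-(E : ℤ)) E)).biUnion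
        (fun ae : ℤ × ℤ ↦ Int.divisorsAntidiag ae.1 ×ˢ Int.divisorsAntidiag ae.2) := by
  rw [mem_biUnion]
  refine ⟨(p * r, q * u), mem_product.mpr ⟨mem_Icc_of_abs_le hA, mem_Icc_of_abs_le hE⟩, ?_⟩
  rw [mem_product]
  exact ⟨Int.mem_divisorsAntidiag.mpr ⟨rfl, hpr⟩, Int.mem_divisorsAntidiag.mpr ⟨rfl, hqu⟩⟩

/-- A set covered by the image of a finset has at most as many elements. [folklore] -/
theorem finite_and_ncard_le_card_of_subset_image {α β : Type*} {S : Set β} {D : Finset α}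
    {F : α → β} (h : S ⊆ F '' ↑D) : S.Finite ∧ S.ncard ≤ D.card := by
  have hfin : (F '' ↑D).Finite := (finite_toSet D).image F
  refine ⟨hfin.subset h, ?_⟩
  calc S.ncard ≤ (F '' ↑D).ncard := Set.ncard_le_ncard h hfin
    _ ≤ (↑D : Set α).ncard := Set.ncard_image_le (finite_toSet D)
    _ = D.card := Set.ncard_coe_finset D

/-- **Family 0: `e = 0`.** The forms with `|a| ≤ A`, `|b| ≤ B`, `|c| ≤ C`, `|d| ≤ D` and `e = 0` are
at most `(2A+1)(2B+1)(2C+1)(2D+1)` ("the number of points with `a ≠ 0` and `e = 0`").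
[cite: BhargavaShankarAnnals2015, Lemma 2.3 (proof; arXiv:1006.1002v2 numbering)] -/
theorem ncard_family_e_zero_le (A B C D : ℕ) :
    {f : BinaryQuartic ℤ | |f.a| ≤ A ∧ |f.b| ≤ B ∧ |f.c| ≤ C ∧ |f.d| ≤ D ∧ f.e = 0}.Finite ∧
    {f : BinaryQuartic ℤ | |f.a| ≤ A ∧ |f.b| ≤ B ∧ |f.c| ≤ C ∧ |f.d| ≤ D ∧ f.e = 0}.ncard ≤
      (2 * A + 1) * (2 * B + 1) * (2 * C + 1) * (2 * D + 1) := by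
  set F : ℤ × ℤ × ℤ × ℤ → BinaryQuartic ℤ := fun x ↦ ⟨x.1, x.2.1, x.2.2.1, x.2.2.2, 0⟩ with hF
  have hsub : {f : BinaryQuartic ℤ | |f.a| ≤ A ∧ |f.b| ≤ B ∧ |f.c| ≤ C ∧ |f.d| ≤ D ∧ f.e = 0} ⊆
      F '' ↑((Icc (-(A : ℤ)) A) ×ˢ (Icc (-(B : ℤ)) B) ×ˢ (Icc (-(C : ℤ)) C) ×ˢ (Icc (-(D : ℤ)) D)) := by
    rintro f ⟨hfa, hfb, hfc, hfd, he⟩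
    refine ⟨(f.a, f.b, f.c, f.d), ?_, ?_⟩
    · simp only [coe_product, Set.mem_prod, mem_coe]
      exact ⟨mem_Icc_of_abs_le hfa, mem_Icc_of_abs_le hfb, mem_Icc_of_abs_le hfc,
        mem_Icc_of_abs_le hfd⟩
    · rw [hF]; ext <;> simp [he]
  obtain ⟨hfin, hle⟩ := finite_and_ncard_le_card_of_subset_image hsub
  refine ⟨hfin, hle.trans_eq ?_⟩
  rw [card_product, card_product, card_product, card_Icc_neg_self, card_Icc_neg_self,
    card_Icc_neg_self, card_Icc_neg_self]
  ring

/-- **Family L: a linear factor.** The forms `(pr, ps + qr, pt + qs, pu + qt, qu)` with `a, e ≠ 0`,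
`|a| ≤ A`, `|b| ≤ B`, `|d| ≤ D`, `|e| ≤ E` are at most `(2A+1)(2E+1)·4K²A^εE^ε · (2B+1)(2D+1)`:
such a form is recovered from `((p, r), (q, u), b, d)` as `s = (b − qr)/p`, `t = (d − pu)/q`,
`c = pt + qs`. [cite: BhargavaShankarAnnals2015, Lemma 2.3 (proof, forms with a rational linear factor; arXiv:1006.1002v2 numbering)] -/
theorem ncard_family_lin_le {ε K : ℝ} (hε : 0 < ε)
    (hK : ∀ n : ℕ, ((n.divisors.card : ℕ) : ℝ) ≤ K * (n : ℝ) ^ ε) (A B D E : ℕ) :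
    {f : BinaryQuartic ℤ | f.a ≠ 0 ∧ f.e ≠ 0 ∧ |f.a| ≤ A ∧ |f.b| ≤ B ∧ |f.d| ≤ D ∧ |f.e| ≤ E ∧
      ∃ p q r s t u : ℤ, f = ⟨p * r, p * s + q * r, p * t + q * s, p * u + q * t, q * u⟩}.Finite ∧
    ({f : BinaryQuartic ℤ | f.a ≠ 0 ∧ f.e ≠ 0 ∧ |f.a| ≤ A ∧ |f.b| ≤ B ∧ |f.d| ≤ D ∧ |f.e| ≤ E ∧
      ∃ p q r s t u : ℤ, f = ⟨p * r, p * s + q * r, p * t + q * s, p * u + q * t, q * u⟩}.ncard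
        : ℝ) ≤ (2 * A + 1) * (2 * E + 1) * (4 * K ^ 2 * (A : ℝ) ^ ε * (E : ℝ) ^ ε) *
          ((2 * B + 1) * (2 * D + 1)) := by
  set DP := ((Icc (-(A : ℤ)) A) ×ˢ (Icc (-(E : ℤ)) E)).biUnion
    (fun ae : ℤ × ℤ ↦ Int.divisorsAntidiag ae.1 ×ˢ Int.divisorsAntidiag ae.2) with hDP
  set F : ((ℤ × ℤ) × (ℤ × ℤ)) × (ℤ × ℤ) → BinaryQuartic ℤ := fun x ↦
    ⟨x.1.1.1 * x.1.1.2, x.2.1,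
      x.1.1.1 * ((x.2.2 - x.1.1.1 * x.1.2.2) / x.1.2.1) + x.1.2.1 * ((x.2.1 - x.1.2.1 * x.1.1.2) / x.1.1.1),
      x.2.2, x.1.2.1 * x.1.2.2⟩ with hF
  have hsub : {f : BinaryQuartic ℤ | f.a ≠ 0 ∧ f.e ≠ 0 ∧ |f.a| ≤ A ∧ |f.b| ≤ B ∧ |f.d| ≤ D ∧
      |f.e| ≤ E ∧ ∃ p q r s t u : ℤ,
        f = ⟨p * r, p * s + q * r, p * t + q * s, p * u + q * t, q * u⟩} ⊆
      F '' ↑(DP ×ˢ ((Icc (-(B : ℤ)) B) ×ˢ (Icc (-(D : ℤ)) D))) := by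
    rintro f ⟨ha, he, hfa, hfb, hfd, hfe, p, q, r, s, t, u, rfl⟩
    simp only at ha he hfa hfb hfd hfe
    have hp : p ≠ 0 := fun h ↦ ha (by rw [h, zero_mul])
    have hq : q ≠ 0 := fun h ↦ he (by rw [h, zero_mul])
    refine ⟨(((p, r), (q, u)), (p * s + q * r, p * u + q * t)), ?_, ?_⟩
    · simp only [coe_product, Set.mem_prod, mem_coe]
      exact ⟨mem_divisorPairs ha he hfa hfe, mem_Icc_of_abs_le hfb, mem_Icc_of_abs_le hfd⟩
    · have h1 : (p * u + q * t - p * u) / q = t := by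
        rw [add_sub_cancel_left, Int.mul_ediv_cancel_left _ hq]
      have h2 : (p * s + q * r - q * r) / p = s := by
        rw [add_sub_cancel_right, Int.mul_ediv_cancel_left _ hp]
      simp only [hF, h1, h2]
  obtain ⟨hfin, hle⟩ := finite_and_ncard_le_card_of_subset_image hsub
  refine ⟨hfin, ?_⟩
  rw [card_product, card_product, card_Icc_neg_self, card_Icc_neg_self] at hle
  have hle' : ({f : BinaryQuartic ℤ | f.a ≠ 0 ∧ f.e ≠ 0 ∧ |f.a| ≤ A ∧ |f.b| ≤ B ∧ |f.d| ≤ D ∧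
      |f.e| ≤ E ∧ ∃ p q r s t u : ℤ,
        f = ⟨p * r, p * s + q * r, p * t + q * s, p * u + q * t, q * u⟩}.ncard : ℝ) ≤
      (DP.card : ℝ) * ((2 * B + 1) * (2 * D + 1)) := by exact_mod_cast hle
  refine hle'.trans (mul_le_mul_of_nonneg_right ?_ (by positivity))
  exact card_divisorPairs_le hε hK A E

/-- **Family Q: two quadratic factors, nonsingular system.** The forms
`(ps, pt + qs, pu + qt + rs, qu + rt, ru)` with `sr − pu ≠ 0`, `a, e ≠ 0`, `|a| ≤ A`, `|b| ≤ B`,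
`|d| ≤ D`, `|e| ≤ E` are at most `(2A+1)(2E+1)·4K²A^εE^ε · (2B+1)(2D+1)`: such a form is recovered
from `((p, s), (r, u), b, d)` by solving the linear system `sq + pt = b`, `uq + rt = d` (display
(11)) for `q, t` and putting `c = pu + qt + rs`.
[cite: BhargavaShankarAnnals2015, Lemma 2.3 (proof, nonsingular case of (11); arXiv:1006.1002v2 numbering)] -/
theorem ncard_family_quad_le {ε K : ℝ} (hε : 0 < ε)
    (hK : ∀ n : ℕ, ((n.divisors.card : ℕ) : ℝ) ≤ K * (n : ℝ) ^ ε) (A B D E : ℕ) :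
    {f : BinaryQuartic ℤ | f.a ≠ 0 ∧ f.e ≠ 0 ∧ |f.a| ≤ A ∧ |f.b| ≤ B ∧ |f.d| ≤ D ∧ |f.e| ≤ E ∧
      ∃ p q r s t u : ℤ, s * r - p * u ≠ 0 ∧
        f = ⟨p * s, p * t + q * s, p * u + q * t + r * s, q * u + r * t, r * u⟩}.Finite ∧
    ({f : BinaryQuartic ℤ | f.a ≠ 0 ∧ f.e ≠ 0 ∧ |f.a| ≤ A ∧ |f.b| ≤ B ∧ |f.d| ≤ D ∧ |f.e| ≤ E ∧
      ∃ p q r s t u : ℤ, s * r - p * u ≠ 0 ∧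
        f = ⟨p * s, p * t + q * s, p * u + q * t + r * s, q * u + r * t, r * u⟩}.ncard : ℝ) ≤
      (2 * A + 1) * (2 * E + 1) * (4 * K ^ 2 * (A : ℝ) ^ ε * (E : ℝ) ^ ε) *
        ((2 * B + 1) * (2 * D + 1)) := by
  set DP := ((Icc (-(A : ℤ)) A) ×ˢ (Icc (-(E : ℤ)) E)).biUnion
    (fun ae : ℤ × ℤ ↦ Int.divisorsAntidiag ae.1 ×ˢ Int.divisorsAntidiag ae.2) with hDP
  set F : ((ℤ × ℤ) × (ℤ × ℤ)) × (ℤ × ℤ) → BinaryQuartic ℤ := fun x ↦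
    ⟨x.1.1.1 * x.1.1.2, x.2.1,
      x.1.1.1 * x.1.2.2
        + ((x.2.1 * x.1.2.1 - x.1.1.1 * x.2.2) / (x.1.1.2 * x.1.2.1 - x.1.1.1 * x.1.2.2))
          * ((x.1.1.2 * x.2.2 - x.1.2.2 * x.2.1) / (x.1.1.2 * x.1.2.1 - x.1.1.1 * x.1.2.2))
        + x.1.2.1 * x.1.1.2,
      x.2.2, x.1.2.1 * x.1.2.2⟩ with hF
  have hsub : {f : BinaryQuartic ℤ | f.a ≠ 0 ∧ f.e ≠ 0 ∧ |f.a| ≤ A ∧ |f.b| ≤ B ∧ |f.d| ≤ D ∧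
      |f.e| ≤ E ∧ ∃ p q r s t u : ℤ, s * r - p * u ≠ 0 ∧
        f = ⟨p * s, p * t + q * s, p * u + q * t + r * s, q * u + r * t, r * u⟩} ⊆
      F '' ↑(DP ×ˢ ((Icc (-(B : ℤ)) B) ×ˢ (Icc (-(D : ℤ)) D))) := by
    rintro f ⟨ha, he, hfa, hfb, hfd, hfe, p, q, r, s, t, u, hδ, rfl⟩
    simp only at ha he hfa hfb hfd hfe
    refine ⟨(((p, s), (r, u)), (p * t + q * s, q * u + r * t)), ?_, ?_⟩
    · simp only [coe_product, Set.mem_prod, mem_coe]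
      exact ⟨mem_divisorPairs ha he hfa hfe, mem_Icc_of_abs_le hfb, mem_Icc_of_abs_le hfd⟩
    · have h1 : ((p * t + q * s) * r - p * (q * u + r * t)) / (s * r - p * u) = q := by
        have : (p * t + q * s) * r - p * (q * u + r * t) = q * (s * r - p * u) := by ring
        rw [this, Int.mul_ediv_cancel _ hδ]
      have h2 : (s * (q * u + r * t) - u * (p * t + q * s)) / (s * r - p * u) = t := by
        have : s * (q * u + r * t) - u * (p * t + q * s) = t * (s * r - p * u) := by ring
        rw [this, Int.mul_ediv_cancel _ hδ]
      simp only [hF, h1, h2]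
  obtain ⟨hfin, hle⟩ := finite_and_ncard_le_card_of_subset_image hsub
  refine ⟨hfin, ?_⟩
  rw [card_product, card_product, card_Icc_neg_self, card_Icc_neg_self] at hle
  have hle' : ({f : BinaryQuartic ℤ | f.a ≠ 0 ∧ f.e ≠ 0 ∧ |f.a| ≤ A ∧ |f.b| ≤ B ∧ |f.d| ≤ D ∧
      |f.e| ≤ E ∧ ∃ p q r s t u : ℤ, s * r - p * u ≠ 0 ∧
        f = ⟨p * s, p * t + q * s, p * u + q * t + r * s, q * u + r * t, r * u⟩}.ncard : ℝ) ≤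
      (DP.card : ℝ) * ((2 * B + 1) * (2 * D + 1)) := by exact_mod_cast hle
  refine hle'.trans (mul_le_mul_of_nonneg_right ?_ (by positivity))
  exact card_divisorPairs_le hε hK A E

/-- **Family S: two quadratic factors, singular system.** The forms
`(ps, pt + qs, pu + qt + rs, qu + rt, ru)` with `sr − pu = 0`, `a, e ≠ 0`, `|a| ≤ A`, `|b| ≤ B`,
`|c| ≤ C`, `|e| ≤ E` are at most `(2A+1)(2E+1)·4K²A^εE^ε · (2B+1)(2C+1)`: here `b` determines
`d = (r/p) b`, so such a form is recovered from `((p, s), (r, u), b, c)`.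
[cite: BhargavaShankarAnnals2015, Lemma 2.3 (proof, singular case of (11): "d = (r/p)b"; arXiv:1006.1002v2 numbering)] -/
theorem ncard_family_quad_singular_le {ε K : ℝ} (hε : 0 < ε)
    (hK : ∀ n : ℕ, ((n.divisors.card : ℕ) : ℝ) ≤ K * (n : ℝ) ^ ε) (A B C E : ℕ) :
    {f : BinaryQuartic ℤ | f.a ≠ 0 ∧ f.e ≠ 0 ∧ |f.a| ≤ A ∧ |f.b| ≤ B ∧ |f.c| ≤ C ∧ |f.e| ≤ E ∧
      ∃ p q r s t u : ℤ, s * r - p * u = 0 ∧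
        f = ⟨p * s, p * t + q * s, p * u + q * t + r * s, q * u + r * t, r * u⟩}.Finite ∧
    ({f : BinaryQuartic ℤ | f.a ≠ 0 ∧ f.e ≠ 0 ∧ |f.a| ≤ A ∧ |f.b| ≤ B ∧ |f.c| ≤ C ∧ |f.e| ≤ E ∧
      ∃ p q r s t u : ℤ, s * r - p * u = 0 ∧
        f = ⟨p * s, p * t + q * s, p * u + q * t + r * s, q * u + r * t, r * u⟩}.ncard : ℝ) ≤
      (2 * A + 1) * (2 * E + 1) * (4 * K ^ 2 * (A : ℝ) ^ ε * (E : ℝ) ^ ε) *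
        ((2 * B + 1) * (2 * C + 1)) := by
  set DP := ((Icc (-(A : ℤ)) A) ×ˢ (Icc (-(E : ℤ)) E)).biUnion
    (fun ae : ℤ × ℤ ↦ Int.divisorsAntidiag ae.1 ×ˢ Int.divisorsAntidiag ae.2) with hDP
  set F : ((ℤ × ℤ) × (ℤ × ℤ)) × (ℤ × ℤ) → BinaryQuartic ℤ := fun x ↦
    ⟨x.1.1.1 * x.1.1.2, x.2.1, x.2.2, x.1.2.1 * x.2.1 / x.1.1.1, x.1.2.1 * x.1.2.2⟩ with hF
  have hsub : {f : BinaryQuartic ℤ | f.a ≠ 0 ∧ f.e ≠ 0 ∧ |f.a| ≤ A ∧ |f.b| ≤ B ∧ |f.c| ≤ C ∧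
      |f.e| ≤ E ∧ ∃ p q r s t u : ℤ, s * r - p * u = 0 ∧
        f = ⟨p * s, p * t + q * s, p * u + q * t + r * s, q * u + r * t, r * u⟩} ⊆
      F '' ↑(DP ×ˢ ((Icc (-(B : ℤ)) B) ×ˢ (Icc (-(C : ℤ)) C))) := by
    rintro f ⟨ha, he, hfa, hfb, hfc, hfe, p, q, r, s, t, u, hδ, rfl⟩
    simp only at ha he hfa hfb hfc hfe
    have hp : p ≠ 0 := fun h ↦ ha (by rw [h, zero_mul])
    refine ⟨(((p, s), (r, u)), (p * t + q * s, p * u + q * t + r * s)), ?_, ?_⟩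
    · simp only [coe_product, Set.mem_prod, mem_coe]
      exact ⟨mem_divisorPairs ha he hfa hfe, mem_Icc_of_abs_le hfb, mem_Icc_of_abs_le hfc⟩
    · have hsr : s * r = p * u := sub_eq_zero.mp hδ
      have h1 : r * (p * t + q * s) / p = q * u + r * t := by
        have : r * (p * t + q * s) = p * (q * u + r * t) := by linear_combination q * hsr
        rw [this, Int.mul_ediv_cancel_left _ hp]
      simp only [hF, h1]
  obtain ⟨hfin, hle⟩ := finite_and_ncard_le_card_of_subset_image hsub
  refine ⟨hfin, ?_⟩
  rw [card_product, card_product, card_Icc_neg_self, card_Icc_neg_self] at hle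
  have hle' : ({f : BinaryQuartic ℤ | f.a ≠ 0 ∧ f.e ≠ 0 ∧ |f.a| ≤ A ∧ |f.b| ≤ B ∧ |f.c| ≤ C ∧
      |f.e| ≤ E ∧ ∃ p q r s t u : ℤ, s * r - p * u = 0 ∧
        f = ⟨p * s, p * t + q * s, p * u + q * t + r * s, q * u + r * t, r * u⟩}.ncard : ℝ) ≤
      (DP.card : ℝ) * ((2 * B + 1) * (2 * C + 1)) := by exact_mod_cast hle
  refine hle'.trans (mul_le_mul_of_nonneg_right ?_ (by positivity))
  exact card_divisorPairs_le hε hK A E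

/-- `(2B+1)(2D+1) ≤ 9BD` for `B, D ≥ 1`. [folklore] -/
theorem nine_mul_mul_ge {B D : ℝ} (hB : 1 ≤ B) (hD : 1 ≤ D) :
    (2 * B + 1) * (2 * D + 1) ≤ 9 * (B * D) := by
  nlinarith [mul_le_mul hB hD zero_le_one (zero_le_one.trans hB)]

/-! ## §4 Lemma 2.3, counting core -/

/-- **Bhargava–Shankar, Lemma 2.3 (counting core, integral box).** For every `ε > 0` there is a
constant `K` such that for all integers `A, B, C, D, E ≥ 1` the number of integral binary quartic
forms `f = ax⁴ + bx³y + cx²y² + dxy³ + ey⁴` with `a ≠ 0`, `f` *not* irreducible (i.e. `f(x,1)`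
reducible over `ℚ`), and `|a| ≤ A`, `|b| ≤ B`, `|c| ≤ C`, `|d| ≤ D`, `|e| ≤ E`, is at most
`K · (AE)^ε · (ABCD + ABDE + ABCE)`. (In the paper the box is that of the coefficients of
`𝓡_X(hL_V^{(i)}) ⊂ N'A'KΛhL_V^{(i)}`: `A ≍ λ⁴t⁻⁴`, `B ≍ λ⁴t⁻²`, `C ≍ λ⁴`, `D ≍ λ⁴t²`, `E ≍ λ⁴t⁴`,
`λ < X^{1/24}`, so that the bound is `O(X^{2/3+ε})`.)
[cite: BhargavaShankarAnnals2015, Lemma 2.3 (arXiv:1006.1002v2 numbering = published numbering)] -/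
theorem ncard_reducible_box_le {ε : ℝ} (hε : 0 < ε) :
    ∃ K : ℝ, 0 < K ∧ ∀ A B C D E : ℕ, 1 ≤ A → 1 ≤ B → 1 ≤ C → 1 ≤ D → 1 ≤ E →
      ({f : BinaryQuartic ℤ | f.a ≠ 0 ∧ ¬ f.IsIrreducible ∧ |f.a| ≤ A ∧ |f.b| ≤ B ∧ |f.c| ≤ C ∧
            |f.d| ≤ D ∧ |f.e| ≤ E}.ncard : ℝ) ≤
        K * ((A : ℝ) * E) ^ ε * (A * B * C * D + A * B * D * E + A * B * C * E) := by
  obtain ⟨K, hK1, hK⟩ := Literature.NumberTheory.Sieve.exists_card_divisors_le_mul_rpow' hε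
  refine ⟨648 * K ^ 2, by positivity, fun A B C D E hA hB hC hD hE ↦ ?_⟩
  -- the four families
  obtain ⟨hfin₀, h₀⟩ := ncard_family_e_zero_le A B C D
  obtain ⟨hfinL, hL⟩ := ncard_family_lin_le hε hK A B D E
  obtain ⟨hfinQ, hQ⟩ := ncard_family_quad_le hε hK A B D E
  obtain ⟨hfinS, hS⟩ := ncard_family_quad_singular_le hε hK A B C E
  set S₀ := {f : BinaryQuartic ℤ | |f.a| ≤ A ∧ |f.b| ≤ B ∧ |f.c| ≤ C ∧ |f.d| ≤ D ∧ f.e = 0}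
    with hS₀
  set SL := {f : BinaryQuartic ℤ | f.a ≠ 0 ∧ f.e ≠ 0 ∧ |f.a| ≤ A ∧ |f.b| ≤ B ∧ |f.d| ≤ D ∧
    |f.e| ≤ E ∧ ∃ p q r s t u : ℤ,
      f = ⟨p * r, p * s + q * r, p * t + q * s, p * u + q * t, q * u⟩} with hSL
  set SQ := {f : BinaryQuartic ℤ | f.a ≠ 0 ∧ f.e ≠ 0 ∧ |f.a| ≤ A ∧ |f.b| ≤ B ∧ |f.d| ≤ D ∧
    |f.e| ≤ E ∧ ∃ p q r s t u : ℤ, s * r - p * u ≠ 0 ∧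
      f = ⟨p * s, p * t + q * s, p * u + q * t + r * s, q * u + r * t, r * u⟩} with hSQ
  set SS := {f : BinaryQuartic ℤ | f.a ≠ 0 ∧ f.e ≠ 0 ∧ |f.a| ≤ A ∧ |f.b| ≤ B ∧ |f.c| ≤ C ∧
    |f.e| ≤ E ∧ ∃ p q r s t u : ℤ, s * r - p * u = 0 ∧
      f = ⟨p * s, p * t + q * s, p * u + q * t + r * s, q * u + r * t, r * u⟩} with hSS
  -- §A the cover (the two shapes of a reducible form)
  have hcover : {f : BinaryQuartic ℤ | f.a ≠ 0 ∧ ¬ f.IsIrreducible ∧ |f.a| ≤ A ∧ |f.b| ≤ B ∧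
      |f.c| ≤ C ∧ |f.d| ≤ D ∧ |f.e| ≤ E} ⊆ S₀ ∪ SL ∪ SQ ∪ SS := by
    rintro f ⟨ha, hirr, hfa, hfb, hfc, hfd, hfe⟩
    by_cases he0 : f.e = 0
    · exact Or.inl (Or.inl (Or.inl ⟨hfa, hfb, hfc, hfd, he0⟩))
    rcases shape_of_not_isIrreducible ha hirr with
      ⟨p, q, r, s, t, u, hf⟩ | ⟨p, q, r, s, t, u, hf⟩
    · exact Or.inl (Or.inl (Or.inr ⟨ha, he0, hfa, hfb, hfd, hfe, p, q, r, s, t, u, hf⟩))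
    · by_cases hδ : s * r - p * u = 0
      · exact Or.inr ⟨ha, he0, hfa, hfb, hfc, hfe, p, q, r, s, t, u, hδ, hf⟩
      · exact Or.inl (Or.inr ⟨ha, he0, hfa, hfb, hfd, hfe, p, q, r, s, t, u, hδ, hf⟩)
  -- §B cardinalities
  have hncard : ({f : BinaryQuartic ℤ | f.a ≠ 0 ∧ ¬ f.IsIrreducible ∧ |f.a| ≤ A ∧ |f.b| ≤ B ∧
      |f.c| ≤ C ∧ |f.d| ≤ D ∧ |f.e| ≤ E}.ncard : ℝ) ≤
      (S₀.ncard : ℝ) + SL.ncard + SQ.ncard + SS.ncard := by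
    have h := Set.ncard_le_ncard hcover (((hfin₀.union hfinL).union hfinQ).union hfinS)
    have h1 := Set.ncard_union_le (S₀ ∪ SL ∪ SQ) SS
    have h2 := Set.ncard_union_le (S₀ ∪ SL) SQ
    have h3 := Set.ncard_union_le S₀ SL
    have h' : {f : BinaryQuartic ℤ | f.a ≠ 0 ∧ ¬ f.IsIrreducible ∧ |f.a| ≤ A ∧ |f.b| ≤ B ∧
        |f.c| ≤ C ∧ |f.d| ≤ D ∧ |f.e| ≤ E}.ncard ≤ S₀.ncard + SL.ncard + SQ.ncard + SS.ncard := by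
      omega
    exact_mod_cast h'
  have h₀' : (S₀.ncard : ℝ) ≤ (2 * A + 1) * (2 * B + 1) * (2 * C + 1) * (2 * D + 1) := by
    exact_mod_cast h₀
  -- §C the final estimate
  have hA' : (1 : ℝ) ≤ A := by exact_mod_cast hA
  have hB' : (1 : ℝ) ≤ B := by exact_mod_cast hB
  have hC' : (1 : ℝ) ≤ C := by exact_mod_cast hC
  have hD' : (1 : ℝ) ≤ D := by exact_mod_cast hD
  have hE' : (1 : ℝ) ≤ E := by exact_mod_cast hE
  have hQ1 : (1 : ℝ) ≤ ((A : ℝ) * E) ^ ε :=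
    Real.one_le_rpow (one_le_mul_of_one_le_of_one_le hA' hE') hε.le
  have hQ0 : (0 : ℝ) ≤ ((A : ℝ) * E) ^ ε := zero_le_one.trans hQ1
  have hsplit : ((A : ℝ) * E) ^ ε = (A : ℝ) ^ ε * (E : ℝ) ^ ε :=
    Real.mul_rpow (by positivity) (by positivity)
  have hK2 : (1 : ℝ) ≤ K ^ 2 := one_le_pow₀ hK1
  have hK0 : (0 : ℝ) ≤ K ^ 2 := zero_le_one.trans hK2
  have hDP' : (2 * A + 1) * (2 * E + 1) * (4 * K ^ 2 * (A : ℝ) ^ ε * (E : ℝ) ^ ε) ≤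
      36 * K ^ 2 * ((A : ℝ) * E) ^ ε * (A * E) := by
    have h1 : (2 * A + 1 : ℝ) ≤ 3 * A := by linarith only [hA']
    have h2 : (2 * E + 1 : ℝ) ≤ 3 * E := by linarith only [hE']
    have h12 : (2 * A + 1 : ℝ) * (2 * E + 1) ≤ (3 * A) * (3 * E) :=
      mul_le_mul h1 h2 (by positivity) (by positivity)
    calc (2 * A + 1) * (2 * E + 1) * (4 * K ^ 2 * (A : ℝ) ^ ε * (E : ℝ) ^ ε)
        = (2 * A + 1) * (2 * E + 1) * (4 * K ^ 2) * ((A : ℝ) ^ ε * (E : ℝ) ^ ε) := by ring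
      _ = (2 * A + 1) * (2 * E + 1) * (4 * K ^ 2) * ((A : ℝ) * E) ^ ε := by rw [hsplit]
      _ ≤ (3 * A) * (3 * E) * (4 * K ^ 2) * ((A : ℝ) * E) ^ ε :=
          mul_le_mul_of_nonneg_right (mul_le_mul_of_nonneg_right h12 (by positivity)) hQ0
      _ = 36 * K ^ 2 * ((A : ℝ) * E) ^ ε * (A * E) := by ring
  have hBD : ((2 * B + 1) * (2 * D + 1) : ℝ) ≤ 9 * (B * D) := nine_mul_mul_ge hB' hD'
  have hBC : ((2 * B + 1) * (2 * C + 1) : ℝ) ≤ 9 * (B * C) := nine_mul_mul_ge hB' hC'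
  have hT₀' : (S₀.ncard : ℝ) ≤ 81 * (A * B * C * D) := by
    refine h₀'.trans ?_
    calc ((2 * A + 1) * (2 * B + 1) * (2 * C + 1) * (2 * D + 1) : ℝ)
        = ((2 * A + 1) * (2 * B + 1)) * ((2 * C + 1) * (2 * D + 1)) := by ring
      _ ≤ (9 * (A * B)) * (9 * (C * D)) :=
          mul_le_mul (nine_mul_mul_ge hA' hB') (nine_mul_mul_ge hC' hD') (by positivity)
            (by positivity)
      _ = 81 * (A * B * C * D) := by ring
  have h36 : (0 : ℝ) ≤ 36 * K ^ 2 * ((A : ℝ) * E) ^ ε * (A * E) := by positivity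
  have hTL' : (SL.ncard : ℝ) ≤ 324 * K ^ 2 * ((A : ℝ) * E) ^ ε * (A * B * D * E) := by
    refine hL.trans ?_
    calc (2 * A + 1) * (2 * E + 1) * (4 * K ^ 2 * (A : ℝ) ^ ε * (E : ℝ) ^ ε) *
          ((2 * B + 1) * (2 * D + 1))
        ≤ (36 * K ^ 2 * ((A : ℝ) * E) ^ ε * (A * E)) * (9 * (B * D)) :=
          mul_le_mul hDP' hBD (by positivity) h36
      _ = 324 * K ^ 2 * ((A : ℝ) * E) ^ ε * (A * B * D * E) := by ring
  have hTQ' : (SQ.ncard : ℝ) ≤ 324 * K ^ 2 * ((A : ℝ) * E) ^ ε * (A * B * D * E) := by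
    refine hQ.trans ?_
    calc (2 * A + 1) * (2 * E + 1) * (4 * K ^ 2 * (A : ℝ) ^ ε * (E : ℝ) ^ ε) *
          ((2 * B + 1) * (2 * D + 1))
        ≤ (36 * K ^ 2 * ((A : ℝ) * E) ^ ε * (A * E)) * (9 * (B * D)) :=
          mul_le_mul hDP' hBD (by positivity) h36
      _ = 324 * K ^ 2 * ((A : ℝ) * E) ^ ε * (A * B * D * E) := by ring
  have hTS' : (SS.ncard : ℝ) ≤ 324 * K ^ 2 * ((A : ℝ) * E) ^ ε * (A * B * C * E) := by
    refine hS.trans ?_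
    calc (2 * A + 1) * (2 * E + 1) * (4 * K ^ 2 * (A : ℝ) ^ ε * (E : ℝ) ^ ε) *
          ((2 * B + 1) * (2 * C + 1))
        ≤ (36 * K ^ 2 * ((A : ℝ) * E) ^ ε * (A * E)) * (9 * (B * C)) :=
          mul_le_mul hDP' hBC (by positivity) h36
      _ = 324 * K ^ 2 * ((A : ℝ) * E) ^ ε * (A * B * C * E) := by ring
  have hKQ1 : (1 : ℝ) ≤ K ^ 2 * ((A : ℝ) * E) ^ ε := one_le_mul_of_one_le_of_one_le hK2 hQ1
  have hKQ : (81 : ℝ) ≤ 648 * K ^ 2 * ((A : ℝ) * E) ^ ε := by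
    rw [mul_assoc]; linarith only [hKQ1]
  have hKQ' : (0 : ℝ) ≤ 648 * K ^ 2 * ((A : ℝ) * E) ^ ε := by positivity
  have hABCD : (0 : ℝ) ≤ A * B * C * D := by positivity
  have hABCE : (0 : ℝ) ≤ A * B * C * E := by positivity
  calc ({f : BinaryQuartic ℤ | f.a ≠ 0 ∧ ¬ f.IsIrreducible ∧ |f.a| ≤ A ∧ |f.b| ≤ B ∧
            |f.c| ≤ C ∧ |f.d| ≤ D ∧ |f.e| ≤ E}.ncard : ℝ)
      ≤ (S₀.ncard : ℝ) + SL.ncard + SQ.ncard + SS.ncard := hncard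
    _ ≤ 81 * (A * B * C * D) + 324 * K ^ 2 * ((A : ℝ) * E) ^ ε * (A * B * D * E) +
          324 * K ^ 2 * ((A : ℝ) * E) ^ ε * (A * B * D * E) +
          324 * K ^ 2 * ((A : ℝ) * E) ^ ε * (A * B * C * E) := by
        linarith only [hT₀', hTL', hTQ', hTS']
    _ ≤ 648 * K ^ 2 * ((A : ℝ) * E) ^ ε * (A * B * C * D) +
          648 * K ^ 2 * ((A : ℝ) * E) ^ ε * (A * B * D * E) +
          648 * K ^ 2 * ((A : ℝ) * E) ^ ε * (A * B * C * E) := by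
        linarith only [mul_le_mul_of_nonneg_right hKQ hABCD, mul_nonneg hKQ' hABCE]
    _ = 648 * K ^ 2 * ((A : ℝ) * E) ^ ε * (A * B * C * D + A * B * D * E + A * B * C * E) := by
        ring

/-- **Bhargava–Shankar, Lemma 2.3 (counting core, real box).** The same bound for real box
parameters `A, B, C, D, E ≥ 1`: the number of integral forms with `a ≠ 0`, not irreducible, and
`|a| ≤ A, …, |e| ≤ E` is at most `K · (AE)^ε · (ABCD + ABDE + ABCE)`.
[cite: BhargavaShankarAnnals2015, Lemma 2.3 (arXiv:1006.1002v2 numbering = published numbering)] -/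
theorem ncard_reducible_realBox_le {ε : ℝ} (hε : 0 < ε) :
    ∃ K : ℝ, 0 < K ∧ ∀ A B C D E : ℝ, 1 ≤ A → 1 ≤ B → 1 ≤ C → 1 ≤ D → 1 ≤ E →
      ({f : BinaryQuartic ℤ | f.a ≠ 0 ∧ ¬ f.IsIrreducible ∧ |(f.a : ℝ)| ≤ A ∧ |(f.b : ℝ)| ≤ B ∧
            |(f.c : ℝ)| ≤ C ∧ |(f.d : ℝ)| ≤ D ∧ |(f.e : ℝ)| ≤ E}.ncard : ℝ) ≤
        K * (A * E) ^ ε * (A * B * C * D + A * B * D * E + A * B * C * E) := by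
  obtain ⟨K, hK0, hK⟩ := ncard_reducible_box_le hε
  refine ⟨K, hK0, fun A B C D E hA hB hC hD hE ↦ ?_⟩
  -- integer parts
  have hfl : ∀ {Y : ℝ}, 1 ≤ Y → 1 ≤ ⌊Y⌋₊ ∧ (⌊Y⌋₊ : ℝ) ≤ Y ∧
      ∀ x : ℤ, |(x : ℝ)| ≤ Y → |x| ≤ (⌊Y⌋₊ : ℕ) := by
    intro Y hY
    refine ⟨Nat.le_floor (by exact_mod_cast hY), Nat.floor_le (by linarith), fun x hx ↦ ?_⟩
    have h0 : (0 : ℝ) ≤ Y := by linarith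
    have hx' : ((|x| : ℤ) : ℝ) ≤ Y := by rwa [Int.cast_abs]
    have : |x| ≤ ⌊Y⌋ := Int.le_floor.mpr hx'
    rwa [← Int.natCast_floor_eq_floor h0] at this
  obtain ⟨hA1, hAle, hAx⟩ := hfl hA
  obtain ⟨hB1, hBle, hBx⟩ := hfl hB
  obtain ⟨hC1, hCle, hCx⟩ := hfl hC
  obtain ⟨hD1, hDle, hDx⟩ := hfl hD
  obtain ⟨hE1, hEle, hEx⟩ := hfl hE
  have hsub : {f : BinaryQuartic ℤ | f.a ≠ 0 ∧ ¬ f.IsIrreducible ∧ |(f.a : ℝ)| ≤ A ∧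
      |(f.b : ℝ)| ≤ B ∧ |(f.c : ℝ)| ≤ C ∧ |(f.d : ℝ)| ≤ D ∧ |(f.e : ℝ)| ≤ E} ⊆
      {f : BinaryQuartic ℤ | f.a ≠ 0 ∧ ¬ f.IsIrreducible ∧ |f.a| ≤ (⌊A⌋₊ : ℕ) ∧
        |f.b| ≤ (⌊B⌋₊ : ℕ) ∧ |f.c| ≤ (⌊C⌋₊ : ℕ) ∧ |f.d| ≤ (⌊D⌋₊ : ℕ) ∧ |f.e| ≤ (⌊E⌋₊ : ℕ)} := by
    rintro f ⟨ha, hirr, h1, h2, h3, h4, h5⟩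
    exact ⟨ha, hirr, hAx _ h1, hBx _ h2, hCx _ h3, hDx _ h4, hEx _ h5⟩
  have hK' := hK ⌊A⌋₊ ⌊B⌋₊ ⌊C⌋₊ ⌊D⌋₊ ⌊E⌋₊ hA1 hB1 hC1 hD1 hE1
  -- the integer box is finite (family 0 with `E` in place of … : embed in a product of intervals)
  have hfin : {f : BinaryQuartic ℤ | f.a ≠ 0 ∧ ¬ f.IsIrreducible ∧ |f.a| ≤ (⌊A⌋₊ : ℕ) ∧
        |f.b| ≤ (⌊B⌋₊ : ℕ) ∧ |f.c| ≤ (⌊C⌋₊ : ℕ) ∧ |f.d| ≤ (⌊D⌋₊ : ℕ) ∧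
        |f.e| ≤ (⌊E⌋₊ : ℕ)}.Finite := by
    set F : ℤ × ℤ × ℤ × ℤ × ℤ → BinaryQuartic ℤ :=
      fun x ↦ ⟨x.1, x.2.1, x.2.2.1, x.2.2.2.1, x.2.2.2.2⟩ with hF
    refine (finite_and_ncard_le_card_of_subset_image (F := F)
      (D := (Icc (-(⌊A⌋₊ : ℤ)) ⌊A⌋₊) ×ˢ (Icc (-(⌊B⌋₊ : ℤ)) ⌊B⌋₊) ×ˢ (Icc (-(⌊C⌋₊ : ℤ)) ⌊C⌋₊) ×ˢ
        (Icc (-(⌊D⌋₊ : ℤ)) ⌊D⌋₊) ×ˢ (Icc (-(⌊E⌋₊ : ℤ)) ⌊E⌋₊)) ?_).1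
    rintro f ⟨-, -, h1, h2, h3, h4, h5⟩
    refine ⟨(f.a, f.b, f.c, f.d, f.e), ?_, ?_⟩
    · simp only [coe_product, Set.mem_prod, mem_coe]
      exact ⟨mem_Icc_of_abs_le h1, mem_Icc_of_abs_le h2, mem_Icc_of_abs_le h3,
        mem_Icc_of_abs_le h4, mem_Icc_of_abs_le h5⟩
    · rw [hF]
  have hmono := Set.ncard_le_ncard hsub hfin
  have hmono' : ({f : BinaryQuartic ℤ | f.a ≠ 0 ∧ ¬ f.IsIrreducible ∧ |(f.a : ℝ)| ≤ A ∧
      |(f.b : ℝ)| ≤ B ∧ |(f.c : ℝ)| ≤ C ∧ |(f.d : ℝ)| ≤ D ∧ |(f.e : ℝ)| ≤ E}.ncard : ℝ) ≤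
      ({f : BinaryQuartic ℤ | f.a ≠ 0 ∧ ¬ f.IsIrreducible ∧ |f.a| ≤ (⌊A⌋₊ : ℕ) ∧
        |f.b| ≤ (⌊B⌋₊ : ℕ) ∧ |f.c| ≤ (⌊C⌋₊ : ℕ) ∧ |f.d| ≤ (⌊D⌋₊ : ℕ) ∧
        |f.e| ≤ (⌊E⌋₊ : ℕ)}.ncard : ℝ) := by exact_mod_cast hmono
  refine hmono'.trans (hK'.trans ?_)
  have hA0 : (0 : ℝ) ≤ ⌊A⌋₊ := by positivity
  have hE0 : (0 : ℝ) ≤ ⌊E⌋₊ := by positivity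
  have hε' : ((⌊A⌋₊ : ℝ) * ⌊E⌋₊) ^ ε ≤ (A * E) ^ ε :=
    Real.rpow_le_rpow (by positivity) (mul_le_mul hAle hEle hE0 (by linarith)) hε.le
  have hsum : ((⌊A⌋₊ : ℝ) * ⌊B⌋₊ * ⌊C⌋₊ * ⌊D⌋₊ + ⌊A⌋₊ * ⌊B⌋₊ * ⌊D⌋₊ * ⌊E⌋₊ +
      ⌊A⌋₊ * ⌊B⌋₊ * ⌊C⌋₊ * ⌊E⌋₊) ≤ A * B * C * D + A * B * D * E + A * B * C * E := by
    gcongr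
  gcongr

end BinaryQuartic

end Literature.NumberTheory.EllipticCurves

end
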